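import Mathlib
import Summits.Ventures.PercRepro.TriangleCapAvoid

/-!
# PercRepro — the matching pairs come in swap pairs: `T` is even, and a matching pair is avoided by
`(T − 2)/2` matching edges (p3, gen 31; part 5 — towards the row `m = k + 3`)

* `filter_mk_eq_eq_pair`, `card_eq_two_mul_card_image` — over a swap-closed set of ordered adjacent pairs the
  map `q ↦ s(q.1, q.2)` has fibres `{q, q.swap}` of size `2`, so the set has twice as many elements as edges;
* `card_T_eq_two_mul` — `T = 2 · #(matching edges)`: `T` is even;
* `swap_mem_Q`, `card_T_le_two_mul_card_avoid_add_two` — for a matching pair `p` the matching pairs off `p`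
  (`≥ T − 2` of them) are swap-closed and their edges avoid `p`: `T ≤ 2 · |avoid p| + 2`;
* **`card_T_mul_card_T_le`** — summed over the matching pairs: `T² ≤ 2Y + 2T`.

Axioms: standard.
-/

namespace PercRepro

namespace TriangleCap

namespace C047

open Finset

variable {V : Type*} [Fintype V] [DecidableEq V]

omit [Fintype V] in
/-- Over a swap-closed set of pairs with distinct coordinates, the fibre of `q ↦ s(q.1, q.2)` over the edge of
`q` is `{q, q.swap}`. -/
theorem filter_mk_eq_eq_pair (S : Finset (V × V)) (hswap : ∀ q ∈ S, q.swap ∈ S) {q : V × V} (hq : q ∈ S) :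
    S.filter (fun q' => s(q'.1, q'.2) = s(q.1, q.2)) = {q, q.swap} := by
  ext q'
  rw [mem_filter, mem_insert, mem_singleton]
  constructor
  · rintro ⟨_, he⟩
    rw [Sym2.eq_iff] at he
    rcases he with ⟨h1, h2⟩ | ⟨h1, h2⟩
    · exact Or.inl (Prod.ext h1 h2)
    · exact Or.inr (Prod.ext h1 h2)
  · rintro (rfl | rfl)
    · exact ⟨hq, rfl⟩
    · refine ⟨hswap q hq, ?_⟩
      rw [Prod.fst_swap, Prod.snd_swap]
      exact Sym2.eq_swap

omit [Fintype V] in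
/-- A swap-closed set of pairs with distinct coordinates has twice as many elements as edges. -/
theorem card_eq_two_mul_card_image (S : Finset (V × V)) (hne : ∀ q ∈ S, q.1 ≠ q.2)
    (hswap : ∀ q ∈ S, q.swap ∈ S) :
    S.card = 2 * (S.image (fun q => s(q.1, q.2))).card := by
  rw [card_eq_sum_card_image (fun q => s(q.1, q.2)) S, mul_comm, ← smul_eq_mul, ← sum_const]
  apply sum_congr rfl
  intro e he
  rw [mem_image] at he
  obtain ⟨q, hq, rfl⟩ := he
  rw [filter_mk_eq_eq_pair S hswap hq, card_pair]
  intro h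
  have h1 := congrArg Prod.fst h
  rw [Prod.fst_swap] at h1
  exact hne q hq h1

/-- The matching pairs of `N(v)` have distinct coordinates. -/
theorem fst_ne_snd_of_mem_T (D : SimpleGraph V) [DecidableRel D.Adj] (v : V) {q : V × V}
    (hq : q ∈ (offPairs D v).filter (fun p => D.Adj v p.1 ∧ D.Adj v p.2)) : q.1 ≠ q.2 := by
  rw [mem_filter, mem_offPairs] at hq
  exact D.ne_of_adj hq.1.1

/-- The matching pairs of `N(v)` are swap-closed. -/
theorem swap_mem_T (D : SimpleGraph V) [DecidableRel D.Adj] (v : V) {q : V × V}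
    (hq : q ∈ (offPairs D v).filter (fun p => D.Adj v p.1 ∧ D.Adj v p.2)) :
    q.swap ∈ (offPairs D v).filter (fun p => D.Adj v p.1 ∧ D.Adj v p.2) := by
  rw [mem_filter] at hq ⊢
  rw [Prod.fst_swap, Prod.snd_swap]
  exact ⟨swap_mem_offPairs D v hq.1, hq.2.2, hq.2.1⟩

/-- **`T` is even:** `T = 2 · #(matching edges)`. -/
theorem card_T_eq_two_mul (D : SimpleGraph V) [DecidableRel D.Adj] (v : V) :
    ((offPairs D v).filter (fun p => D.Adj v p.1 ∧ D.Adj v p.2)).card =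
      2 * (((offPairs D v).filter (fun p => D.Adj v p.1 ∧ D.Adj v p.2)).image
        (fun q => s(q.1, q.2))).card :=
  card_eq_two_mul_card_image _ (fun _ hq => fst_ne_snd_of_mem_T D v hq) (fun _ hq => swap_mem_T D v hq)

/-- The matching pairs starting off a matching pair `p` are swap-closed (their second coordinates are off `p`
too, by the matching property). -/
theorem swap_mem_Q (D : SimpleGraph V) [DecidableRel D.Adj] (hK : K4mFree D) (v : V) {p q : V × V}
    (hp : p ∈ (offPairs D v).filter (fun p => D.Adj v p.1 ∧ D.Adj v p.2))
    (hq : q ∈ ((offPairs D v).filter (fun p => D.Adj v p.1 ∧ D.Adj v p.2)).filter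
      (fun q => ¬ (q.1 = p.1 ∨ q.1 = p.2))) :
    q.swap ∈ ((offPairs D v).filter (fun p => D.Adj v p.1 ∧ D.Adj v p.2)).filter
      (fun q => ¬ (q.1 = p.1 ∨ q.1 = p.2)) := by
  rw [mem_filter] at hq
  obtain ⟨hqT, hq1⟩ := hq
  push Not at hq1
  obtain ⟨h3, h4⟩ := snd_ne_of_mem_T_of_fst_ne D hK v hp hqT hq1.1 hq1.2
  rw [mem_filter, Prod.fst_swap]
  push Not
  exact ⟨swap_mem_T D v hqT, h3, h4⟩

/-- **A matching pair is avoided by at least `(T − 2)/2` matching edges:** `T ≤ 2 · |avoid p| + 2`. -/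
theorem card_T_le_two_mul_card_avoid_add_two (D : SimpleGraph V) [DecidableRel D.Adj] (hK : K4mFree D)
    (v : V) {p : V × V} (hp : p ∈ (offPairs D v).filter (fun p => D.Adj v p.1 ∧ D.Adj v p.2)) :
    ((offPairs D v).filter (fun p => D.Adj v p.1 ∧ D.Adj v p.2)).card ≤ 2 * (avoid D v p).card + 2 := by
  set Tset := (offPairs D v).filter (fun p => D.Adj v p.1 ∧ D.Adj v p.2) with hTset
  have hsplit := card_filter_add_card_filter_not (s := Tset) (fun q => q.1 = p.1 ∨ q.1 = p.2)
  have hF : (Tset.filter (fun q => q.1 = p.1 ∨ q.1 = p.2)).card ≤ 2 := by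
    rw [filter_or]
    refine (card_union_le _ _).trans ?_
    have h1 := card_filter_T_fst_le_one D hK v p.1
    have h2 := card_filter_T_fst_le_one D hK v p.2
    rw [← hTset] at h1 h2
    omega
  set Q := Tset.filter (fun q => ¬ (q.1 = p.1 ∨ q.1 = p.2)) with hQ
  have hQ2 : Q.card = 2 * (Q.image (fun q => s(q.1, q.2))).card :=
    card_eq_two_mul_card_image Q (fun q hq => fst_ne_snd_of_mem_T D v (mem_filter.mp hq).1)
      (fun q hq => swap_mem_Q D hK v hp hq)
  have hsub : Q.image (fun q => s(q.1, q.2)) ⊆ avoid D v p := by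
    intro e he
    rw [mem_image] at he
    obtain ⟨q, hq, rfl⟩ := he
    rw [hQ, mem_filter] at hq
    push Not at hq
    obtain ⟨h3, h4⟩ := snd_ne_of_mem_T_of_fst_ne D hK v hp hq.1 hq.2.1 hq.2.2
    exact mk_mem_avoid_of_T D v hq.1 hq.2.1 hq.2.2 h3 h4
  have := card_le_card hsub
  omega

/-- **`T² ≤ 2Y + 2T`:** summed over the matching pairs. -/
theorem card_T_mul_card_T_le (D : SimpleGraph V) [DecidableRel D.Adj] (hK : K4mFree D) (v : V) :
    ((offPairs D v).filter (fun p => D.Adj v p.1 ∧ D.Adj v p.2)).card *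
        ((offPairs D v).filter (fun p => D.Adj v p.1 ∧ D.Adj v p.2)).card ≤
      2 * ∑ p ∈ offPairs D v, (avoid D v p).card +
        2 * ((offPairs D v).filter (fun p => D.Adj v p.1 ∧ D.Adj v p.2)).card := by
  set Tset := (offPairs D v).filter (fun p => D.Adj v p.1 ∧ D.Adj v p.2) with hTset
  have h1 := card_nsmul_le_sum Tset (fun p => 2 * (avoid D v p).card + 2) Tset.card
    (fun p hp => card_T_le_two_mul_card_avoid_add_two D hK v hp)
  rw [sum_add_distrib, ← mul_sum, sum_const, smul_eq_mul, smul_eq_mul] at h1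
  have h2 : ∑ p ∈ Tset, (avoid D v p).card ≤ ∑ p ∈ offPairs D v, (avoid D v p).card :=
    sum_le_sum_of_subset (filter_subset _ _)
  nlinarith [h1, h2]

end C047

end TriangleCap

end PercRepro
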